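import Summits.AtomisticToContinuum.FouriersLaw.Theorems.LocalOhmBVLocalOhmStubFiniteResponsePackageAux1
import Summits.AtomisticToContinuum.FouriersLaw.Theorems.ParityLiouvilleSeedWindowLimitDefs
import Summits.AtomisticToContinuum.FouriersLaw.Theorems.ParityLiouvilleSeedWindowLimitStationarity
import Summits.AtomisticToContinuum.FouriersLaw.Theorems.LatticeLandauDampingAbelThermodynamicLimitBulkWindowEquivalence
import Summits.AtomisticToContinuum.FouriersLaw.Theorems.OddSectorIrreversibilitySubBallisticWindowGibbsMoments
import Summits.AtomisticToContinuum.FouriersLaw.Theorems.OddSectorIrreversibilitySubBallisticWindowGibbsPoincare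
import Literature.MathematicalPhysics.KineticTheory.InfiniteChainGibbsStationarityPinned
import Literature.MathematicalPhysics.KineticTheory.InfiniteChainGoodSetSymmetries

/-!
# Thermodynamic limit of deep-window Gibbs expectations, and integrability of window observables, for polynomial growth

Helper for stub `stub_equilibriumPackage` (S2b; clauses (b1) infinite volume and (b4)) of the birth line of crux
`LocalOhmBV.LocalOhm` (item stmt-AtomisticToContinuum-12009). (b1) under a shift-invariant Gibbs state of the pinned
chain every window observable `g ∘ boxRestrictAt a n` with `g` continuous, `|g(y)| ≤ C₀ (1 + ‖y‖)^m`, is integrable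
(one-site moments from superstability). (b4) the tree's bulk equivalence of ensembles
`AbelThermodynamicLimit.SeriesLawAtEveryLaplaceFrequency.stub_bulkWindowEquivalence` (bounded measurable window
observables) is extended to such `g`, in the `boxRestrictAt a n ∘ embed N c` bookkeeping of the local-Ohm line:
truncate at level `M` (`|g - g_M| ≤ g²/M`) and control the tails by window second moments, uniform in `N` and in the
window on the finite side (`SubBallisticWindow.GibbsMoments.stub_gibbsMoments` with `…GibbsPoincare.stub_gibbsPoincare`)
and by the one-site moments of the infinite-volume state. Folklore; no definitions.
-/

set_option autoImplicit false

noncomputable section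

namespace Summit.AtomisticToContinuum.FouriersLaw.Theorems.LocalOhmBirth

open MeasureTheory
open Literature.MathematicalPhysics.KineticTheory Literature.MathematicalPhysics.KineticTheory.HeatConduction
open Summit.AtomisticToContinuum.FouriersLaw.Theorems.WindowLimit (embed embed_apply_of one_add_pow_le_two_pow_mul)
open Summit.AtomisticToContinuum.FouriersLaw.Theorems.LightConeBondHeat
  (pinnedChain_integrable_mul_gibbsDensity_of_le_pow)
open Summit.AtomisticToContinuum.FouriersLaw.Theorems.AbelThermodynamicLimit.SeriesLawAtEveryLaplaceFrequency
  (stub_bulkWindowEquivalence)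
open Summit.AtomisticToContinuum.FouriersLaw.Theorems.SubBallisticWindow

/-- Truncation at level `M > 0`: `g_M = (-M) ∨ (t ∧ M)` has `|g_M| ≤ M` and `|t - g_M| ≤ t²/M`. [folklore] -/
theorem abs_trunc_le_and_abs_sub_trunc_le {M : ℝ} (hM : 0 < M) (t : ℝ) :
    |max (-M) (min t M)| ≤ M ∧ |t - max (-M) (min t M)| ≤ t ^ 2 / M := by
  constructor
  · exact abs_le.2 ⟨le_max_left _ _, max_le (by linarith) (min_le_right _ _)⟩
  · rcases le_or_gt t M with h1 | h1
    · rcases le_or_gt (-M) t with h2 | h2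
      · have h : max (-M) (min t M) = t := by rw [min_eq_left h1, max_eq_right h2]
        rw [h, sub_self, abs_zero]; positivity
      · have h : max (-M) (min t M) = -M := by rw [min_eq_left h1, max_eq_left h2.le]
        rw [h, sub_neg_eq_add, abs_of_nonpos (by linarith), le_div_iff₀ hM]; nlinarith
    · have h : max (-M) (min t M) = M := by rw [min_eq_right h1.le, max_eq_right (by linarith)]
      rw [h, abs_of_nonneg (by linarith), le_div_iff₀ hM]; nlinarith

/-- `(1 + ‖y‖)^m ≤ ∑_i 2^m (1 + |q_i|^m + |p_i|^m)` for a window `y = (q_i, p_i)_{i ≤ n}` (sup norm). [folklore] -/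
theorem one_add_norm_pow_le_sum_sites {n : ℕ} (y : Fin (n + 1) → ℝ × ℝ) (m : ℕ) :
    (1 + ‖y‖) ^ m ≤ ∑ i : Fin (n + 1), 2 ^ m * (1 + |(y i).1| ^ m + |(y i).2| ^ m) := by
  obtain ⟨i₀, -, hi₀⟩ := Finset.exists_max_image Finset.univ (fun i => ‖y i‖) Finset.univ_nonempty
  have hy : ‖y‖ ≤ ‖y i₀‖ := (pi_norm_le_iff_of_nonneg (norm_nonneg _)).2 fun i => hi₀ i (Finset.mem_univ i)
  have h1 : (1 + ‖y‖) ^ m ≤ (1 + ‖y i₀‖) ^ m := pow_le_pow_left₀ (by positivity) (by linarith) m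
  have h2 : (1 + ‖y i₀‖) ^ m ≤ 2 ^ m * (1 + ‖y i₀‖ ^ m) := one_add_pow_le_two_pow_mul (norm_nonneg _) m
  have h3 : ‖y i₀‖ ^ m ≤ |(y i₀).1| ^ m + |(y i₀).2| ^ m := by
    rw [Prod.norm_def, Real.norm_eq_abs, Real.norm_eq_abs]
    rcases le_total |(y i₀).1| |(y i₀).2| with h | h
    · rw [max_eq_right h]; linarith [pow_nonneg (abs_nonneg (y i₀).1) m]
    · rw [max_eq_left h]; linarith [pow_nonneg (abs_nonneg (y i₀).2) m]
  have h4 : 2 ^ m * (1 + |(y i₀).1| ^ m + |(y i₀).2| ^ m) ≤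
      ∑ i : Fin (n + 1), 2 ^ m * (1 + |(y i).1| ^ m + |(y i).2| ^ m) :=
    Finset.single_le_sum (f := fun i => (2 : ℝ) ^ m * (1 + |(y i).1| ^ m + |(y i).2| ^ m))
      (fun i _ => by positivity) (Finset.mem_univ i₀)
  calc (1 + ‖y‖) ^ m ≤ 2 ^ m * (1 + ‖y i₀‖ ^ m) := h1.trans h2
    _ ≤ 2 ^ m * (1 + |(y i₀).1| ^ m + |(y i₀).2| ^ m) := by
        rw [add_assoc]; exact mul_le_mul_of_nonneg_left (by linarith) (by positivity)
    _ ≤ _ := h4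

/-- Re-pairing a window of phase space does not increase the sup norm. [folklore] -/
theorem norm_zip_le {n : ℕ} (w : PhaseSpace (n + 1)) : ‖(fun j : Fin (n + 1) => (w.1 j, w.2 j))‖ ≤ ‖w‖ :=
  (pi_norm_le_iff_of_nonneg (norm_nonneg w)).2 fun j => by
    rw [Prod.norm_def]
    exact max_le ((norm_le_pi_norm w.1 j).trans (norm_fst_le w)) ((norm_le_pi_norm w.2 j).trans (norm_snd_le w))

variable {ω₂ lam β : ℝ}

/-- Gibbs integrability (finite `N`) of a continuous observable of polynomial growth. [folklore] -/
theorem integrable_gibbsMeasure_of_polyBound (hω : 0 < ω₂) (hl : 0 ≤ lam) (hβ : 0 ≤ β) (γ : ℝ) (N : ℕ)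
    {T : ℝ} (hT : 0 < T) {g : PhaseSpace N → ℝ} (hg : Continuous g) {C₀ : ℝ} {m : ℕ}
    (hle : ∀ x, |g x| ≤ C₀ * (1 + ‖x‖) ^ m) : Integrable g ((pinnedChain ω₂ lam β γ).gibbsMeasure N T) := by
  have hC0 : 0 ≤ C₀ := by
    have h := hle 0
    rw [norm_zero, add_zero, one_pow, mul_one] at h
    exact (abs_nonneg _).trans h
  refine (pinnedChain ω₂ lam β γ).integrable_gibbsMeasure (pinnedChain_integrable_mul_gibbsDensity_of_le_pow hω hl
    hβ γ N hT m hg (C := C₀ * (max 2 (2 * max ω₂⁻¹ 1)) ^ m) fun x => (hle x).trans ?_)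
  rw [mul_assoc]
  exact mul_le_mul_of_nonneg_left (one_add_norm_pow_le_pow_mul hω hl hβ γ m x) hC0

/-- **`N`-uniform one-site even moments of the finite-volume Gibbs state** `μ_T = gibbsMeasure N T` of the
pinned chain: `∫ q_i^{2m} dμ_T, ∫ p_i^{2m} dμ_T ≤ C(m)` for all `N`, `i`. [folklore] -/
theorem pinnedChain_gibbsMeasure_even_moments_le (γ : ℝ) (hω : 0 < ω₂) (hl : 0 ≤ lam) (hβ : 0 ≤ β) {T : ℝ}
    (hT : 0 < T) (m : ℕ) :
    ∃ C : ℝ, 0 ≤ C ∧ ∀ (N : ℕ) (i : Fin N),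
      ∫ x, (x.1 i) ^ (2 * m) ∂((pinnedChain ω₂ lam β γ).gibbsMeasure N T) ≤ C ∧
        ∫ x, (x.2 i) ^ (2 * m) ∂((pinnedChain ω₂ lam β γ).gibbsMeasure N T) ≤ C := by
  obtain ⟨C, hC⟩ := GibbsMoments.stub_gibbsMoments ω₂ lam β γ hω hl hβ T hT
    (GibbsPoincare.stub_gibbsPoincare ω₂ lam β γ hω hl hβ T hT) m
  refine ⟨max C 0, le_max_right _ _, fun N i => ?_⟩
  have hZ : 0 < ∫ x, (pinnedChain ω₂ lam β γ).gibbsDensity N T x :=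
    integral_exp_pos (pinnedChain_integrable_gibbsDensity hω hl hβ γ N hT)
  have hZ' : (∫ x : PhaseSpace N, Real.exp (-((pinnedChain ω₂ lam β γ).hamiltonian N x) / T)) =
      ∫ x, (pinnedChain ω₂ lam β γ).gibbsDensity N T x := rfl
  have key : ∀ f : PhaseSpace N → ℝ,
      ∫ x, f x ∂(volume.withDensity fun x : PhaseSpace N =>
          ENNReal.ofReal (Real.exp (-((pinnedChain ω₂ lam β γ).hamiltonian N x) / T))) ≤
        C * ∫ x : PhaseSpace N, Real.exp (-((pinnedChain ω₂ lam β γ).hamiltonian N x) / T) →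
      ∫ x, f x ∂((pinnedChain ω₂ lam β γ).gibbsMeasure N T) ≤ max C 0 := by
    intro f hf
    rw [GibbsMoments.integral_gibbs γ N rfl f, hZ'] at hf
    rw [(pinnedChain ω₂ lam β γ).integral_gibbsMeasure f]
    calc (∫ x, (pinnedChain ω₂ lam β γ).gibbsDensity N T x)⁻¹ *
          ∫ x, f x * (pinnedChain ω₂ lam β γ).gibbsDensity N T x
        ≤ (∫ x, (pinnedChain ω₂ lam β γ).gibbsDensity N T x)⁻¹ *
          (max C 0 * ∫ x, (pinnedChain ω₂ lam β γ).gibbsDensity N T x) :=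
          mul_le_mul_of_nonneg_left (hf.trans (mul_le_mul_of_nonneg_right (le_max_left _ _) hZ.le))
            (inv_nonneg.2 hZ.le)
      _ = max C 0 := by field_simp
  exact ⟨key _ (hC N i).1, key _ (hC N i).2⟩

/-- **`N`-uniform window second moments (finite side).** For continuous `g` with `|g(y)| ≤ C₀ (1 + ‖y‖)^m` there is
`K` with `∫ g(z|_{i,…,i+n})² dμ_{N,T} ≤ K` for every `N` and every window inside the chain. [folklore] -/
theorem pinnedChain_gibbsMeasure_window_sq_le (γ : ℝ) (hω : 0 < ω₂) (hl : 0 ≤ lam) (hβ : 0 ≤ β) {T : ℝ}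
    (hT : 0 < T) (n : ℕ) {g : (Fin (n + 1) → ℝ × ℝ) → ℝ} (hg : Continuous g) {C₀ : ℝ} {m : ℕ}
    (hle : ∀ y, |g y| ≤ C₀ * (1 + ‖y‖) ^ m) :
    ∃ K : ℝ, 0 ≤ K ∧ ∀ (N i : ℕ) (h : i + n < N),
      Integrable (fun z : PhaseSpace N => g fun j : Fin (n + 1) =>
          (z.1 ⟨i + j.val, by omega⟩, z.2 ⟨i + j.val, by omega⟩)) ((pinnedChain ω₂ lam β γ).gibbsMeasure N T) ∧
      Integrable (fun z : PhaseSpace N => (g fun j : Fin (n + 1) =>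
          (z.1 ⟨i + j.val, by omega⟩, z.2 ⟨i + j.val, by omega⟩)) ^ 2) ((pinnedChain ω₂ lam β γ).gibbsMeasure N T) ∧
      ∫ z, (g fun j : Fin (n + 1) => (z.1 ⟨i + j.val, by omega⟩, z.2 ⟨i + j.val, by omega⟩)) ^ 2
        ∂((pinnedChain ω₂ lam β γ).gibbsMeasure N T) ≤ K := by
  obtain ⟨C, hC0, hC⟩ := pinnedChain_gibbsMeasure_even_moments_le γ hω hl hβ hT m
  have hC₀ : 0 ≤ C₀ := by
    have h := hle 0
    rw [norm_zero, add_zero, one_pow, mul_one] at h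
    exact (abs_nonneg _).trans h
  refine ⟨C₀ ^ 2 * ∑ _j : Fin (n + 1), (2 : ℝ) ^ (2 * m) * (1 + C + C), by positivity, fun N i h => ?_⟩
  set μ := (pinnedChain ω₂ lam β γ).gibbsMeasure N T with hμ
  haveI : IsProbabilityMeasure μ := pinnedChain_isProbabilityMeasure_gibbsMeasure hω hl hβ γ N hT
  set win : PhaseSpace N → (Fin (n + 1) → ℝ × ℝ) := fun z j =>
    (z.1 ⟨i + j.val, by omega⟩, z.2 ⟨i + j.val, by omega⟩) with hwin
  have hwc : Continuous win := continuous_pi fun j =>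
    ((continuous_apply _).comp continuous_fst).prodMk ((continuous_apply _).comp continuous_snd)
  have hwn : ∀ z, ‖win z‖ ≤ ‖z‖ := fun z => (pi_norm_le_iff_of_nonneg (norm_nonneg z)).2 fun j => by
    rw [Prod.norm_def]
    exact max_le ((norm_le_pi_norm z.1 _).trans (norm_fst_le z)) ((norm_le_pi_norm z.2 _).trans (norm_snd_le z))
  have hgw : ∀ z, |g (win z)| ≤ C₀ * (1 + ‖z‖) ^ m := fun z =>
    (hle _).trans (mul_le_mul_of_nonneg_left (pow_le_pow_left₀ (by positivity) (by linarith [hwn z]) m) hC₀)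
  have hI1 : Integrable (fun z => g (win z)) μ :=
    integrable_gibbsMeasure_of_polyBound hω hl hβ γ N hT (hg.comp hwc) hgw
  have hI2 : Integrable (fun z => (g (win z)) ^ 2) μ := by
    refine integrable_gibbsMeasure_of_polyBound hω hl hβ γ N hT ((hg.comp hwc).pow 2) (C₀ := C₀ ^ 2)
      (m := 2 * m) fun z => ?_
    rw [abs_pow, pow_mul', ← mul_pow]
    exact pow_le_pow_left₀ (abs_nonneg _) (hgw z) 2
  refine ⟨hI1, hI2, ?_⟩
  -- pointwise domination by one-site monomials
  have hmono : ∀ k : Fin N, Integrable (fun z : PhaseSpace N => (z.1 k) ^ (2 * m)) μ ∧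
      Integrable (fun z : PhaseSpace N => (z.2 k) ^ (2 * m)) μ := fun k =>
    ⟨integrable_gibbsMeasure_of_polyBound hω hl hβ γ N hT (((continuous_apply k).comp continuous_fst).pow _)
        (C₀ := 1) (m := 2 * m) fun z => by
          rw [one_mul, abs_pow, ← Real.norm_eq_abs]
          exact pow_le_pow_left₀ (norm_nonneg _) (((norm_le_pi_norm z.1 k).trans (norm_fst_le z)).trans
            (by linarith [norm_nonneg z])) _,
      integrable_gibbsMeasure_of_polyBound hω hl hβ γ N hT (((continuous_apply k).comp continuous_snd).pow _)
        (C₀ := 1) (m := 2 * m) fun z => by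
          rw [one_mul, abs_pow, ← Real.norm_eq_abs]
          exact pow_le_pow_left₀ (norm_nonneg _) (((norm_le_pi_norm z.2 k).trans (norm_snd_le z)).trans
            (by linarith [norm_nonneg z])) _⟩
  have hA : ∀ k k' : Fin N, Integrable (fun z : PhaseSpace N => 1 + z.1 k ^ (2 * m) + z.2 k' ^ (2 * m)) μ :=
    fun k k' => ((integrable_const 1).add (hmono k).1).add (hmono k').2
  have hB : ∀ k : Fin N, Integrable (fun z : PhaseSpace N => (1 : ℝ) + z.1 k ^ (2 * m)) μ := fun k =>
    (integrable_const 1).add (hmono k).1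
  have hdomI : Integrable (fun z : PhaseSpace N => C₀ ^ 2 * ∑ j : Fin (n + 1), (2 : ℝ) ^ (2 * m) *
      (1 + (z.1 ⟨i + j.val, by omega⟩) ^ (2 * m) + (z.2 ⟨i + j.val, by omega⟩) ^ (2 * m))) μ := by
    refine Integrable.const_mul (integrable_finsetSum Finset.univ fun j _ => Integrable.const_mul ?_ _) _
    exact ((integrable_const 1).add (hmono _).1).add (hmono _).2
  have hdom : ∀ z : PhaseSpace N, (g (win z)) ^ 2 ≤ C₀ ^ 2 * ∑ j : Fin (n + 1), (2 : ℝ) ^ (2 * m) *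
      (1 + (z.1 ⟨i + j.val, by omega⟩) ^ (2 * m) + (z.2 ⟨i + j.val, by omega⟩) ^ (2 * m)) := by
    intro z
    have h1 : (g (win z)) ^ 2 ≤ (C₀ * (1 + ‖win z‖) ^ m) ^ 2 := by
      rw [← sq_abs]; exact pow_le_pow_left₀ (abs_nonneg _) (hle _) 2
    have h2 := one_add_norm_pow_le_sum_sites (win z) (2 * m)
    rw [mul_pow, ← pow_mul, mul_comm m 2] at h1
    refine h1.trans (mul_le_mul_of_nonneg_left (h2.trans (le_of_eq (Finset.sum_congr rfl fun j _ => ?_)))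
      (sq_nonneg _))
    simp only [hwin, Even.pow_abs (even_two_mul m)]
  calc ∫ z, (g (win z)) ^ 2 ∂μ
      ≤ ∫ z, C₀ ^ 2 * ∑ j : Fin (n + 1), (2 : ℝ) ^ (2 * m) *
          (1 + (z.1 ⟨i + j.val, by omega⟩) ^ (2 * m) + (z.2 ⟨i + j.val, by omega⟩) ^ (2 * m)) ∂μ :=
        integral_mono hI2 hdomI hdom
    _ = C₀ ^ 2 * ∑ j : Fin (n + 1), (2 : ℝ) ^ (2 * m) *
          (1 + ∫ z, (z.1 ⟨i + j.val, by omega⟩) ^ (2 * m) ∂μ + ∫ z, (z.2 ⟨i + j.val, by omega⟩) ^ (2 * m) ∂μ) := by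
        rw [integral_const_mul, integral_finsetSum _ fun j _ => (hA _ _).const_mul _]
        refine congrArg _ (Finset.sum_congr rfl fun j _ => ?_)
        rw [integral_const_mul, integral_add (hB _) (hmono _).2, integral_add (integrable_const _) (hmono _).1]
        simp
    _ ≤ C₀ ^ 2 * ∑ _j : Fin (n + 1), (2 : ℝ) ^ (2 * m) * (1 + C + C) := by
        refine mul_le_mul_of_nonneg_left (Finset.sum_le_sum fun j _ =>
          mul_le_mul_of_nonneg_left ?_ (by positivity)) (sq_nonneg _)
        linarith [(hC N ⟨i + j.val, by omega⟩).1, (hC N ⟨i + j.val, by omega⟩).2]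

/-- Window observables of polynomial growth are integrable under a shift-invariant Gibbs state of the pinned
chain (one-site moments from superstability). [folklore] -/
theorem integrable_comp_boxRestrictAt_of_polyBound (γ : ℝ) (hω : 0 < ω₂) (hl : 0 ≤ lam) (hβ : 0 ≤ β)
    {T : ℝ} (hT : 0 < T) {μ : Measure ChainConfig} (hμ : (pinnedChain ω₂ lam β γ).IsChainGibbsMeasure T μ)
    (hS : IsShiftInvariant μ) (a : ℤ) (n : ℕ) {g : (Fin (n + 1) → ℝ × ℝ) → ℝ} (hg : Continuous g)
    (hb : ∃ (C₀ : ℝ) (m : ℕ), ∀ y, |g y| ≤ C₀ * (1 + ‖y‖) ^ m) :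
    Integrable (fun σ => g (boxRestrictAt a n σ)) μ := by
  haveI : IsProbabilityMeasure μ := hμ.isProbabilityMeasure
  obtain ⟨C₀, m, hle⟩ := hb
  obtain ⟨C, hC⟩ :=
    OscillatorChain.exists_integral_abs_pow_add_le_pinnedChain_of_isShiftInvariant γ hω hl hβ hT hμ hS m
  have hdom : Integrable (fun σ : ChainConfig =>
      C₀ * ∑ i : Fin (n + 1), 2 ^ m * (1 + (|(σ (a + i)).1| ^ m + |(σ (a + i)).2| ^ m))) μ := by
    refine Integrable.const_mul (integrable_finsetSum Finset.univ fun i _ => Integrable.const_mul ?_ _) _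
    exact (integrable_const 1).add (hC (a + i)).1
  refine hdom.mono' ((hg.measurable.comp (boxRestrictAt_measurable a n)).aestronglyMeasurable)
    (Filter.Eventually.of_forall fun σ => ?_)
  have hC0 : 0 ≤ C₀ := by
    have h := hle 0
    rw [norm_zero, add_zero, one_pow, mul_one] at h
    exact (abs_nonneg _).trans h
  rw [Real.norm_eq_abs]
  refine (hle _).trans (mul_le_mul_of_nonneg_left ?_ hC0)
  refine (one_add_norm_pow_le_sum_sites _ m).trans (le_of_eq (Finset.sum_congr rfl fun i _ => ?_))
  rw [boxRestrictAt_apply, add_assoc]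

/-- Expectations of window observables under a shift-invariant state do not depend on the anchor. [folklore] -/
theorem integral_comp_boxRestrictAt_eq_anchor_zero {μ : Measure ChainConfig} (hS : IsShiftInvariant μ) (a : ℤ)
    (n : ℕ) {g : (Fin (n + 1) → ℝ × ℝ) → ℝ} (hg : Measurable g) :
    ∫ σ, g (boxRestrictAt a n σ) ∂μ = ∫ σ, g (boxRestrictAt 0 n σ) ∂μ := by
  have hmp := hS.measurePreserving_chainShift a
  have h : ∀ σ : ChainConfig, boxRestrictAt a n σ = boxRestrictAt 0 n (chainShift a σ) := fun σ => by
    funext j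
    simp only [boxRestrictAt_apply]
    show σ (a + j) = σ (0 + j + a)
    rw [zero_add, add_comm]
  have e := integral_map (μ := μ) hmp.measurable.aemeasurable (f := fun σ => g (boxRestrictAt 0 n σ))
    (hg.comp (boxRestrictAt_measurable 0 n)).aestronglyMeasurable
  rw [hmp.map_eq] at e
  simp_rw [h]
  exact e.symm

/-- **(b4) Anchor-uniform thermodynamic limit of deep-window Gibbs expectations of continuous observables of
polynomial growth** (pinned chain, parameters `> 0`, `T > 0`; `μT` shift-invariant Gibbs with superstability):
windows `L`-deep in a chain of length `N ≥ N₀` have expectation `ε`-close to `∫ g ∘ boxRestrictAt a n dμT`. [folklore] -/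
theorem tendsto_window_gibbsMeasure_of_polyBound (γ : ℝ) (hω : 0 < ω₂) (hl : 0 < lam) (hβ : 0 < β)
    (hγ : 0 < γ) {T : ℝ} (hT : 0 < T) {μT : Measure ChainConfig}
    (hG : (pinnedChain ω₂ lam β γ).IsChainGibbsMeasure T μT) (hS : IsShiftInvariant μT)
    (hSS : (pinnedChain ω₂ lam β γ).HasSuperstabilityEstimate μT) (n : ℕ) (g : (Fin (n + 1) → ℝ × ℝ) → ℝ)
    (hg : Continuous g) (hb : ∃ (C₀ : ℝ) (m : ℕ), ∀ y, |g y| ≤ C₀ * (1 + ‖y‖) ^ m) (ε : ℝ) (hε : 0 < ε) :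
    ∃ L N₀ : ℕ, ∀ (N c : ℕ) (a : ℤ), N₀ ≤ N → (L : ℤ) ≤ a + c → a + c + n + L < N →
      |(∫ z, g (boxRestrictAt a n (embed N c z)) ∂((pinnedChain ω₂ lam β γ).gibbsMeasure N T)) -
          ∫ σ, g (boxRestrictAt a n σ) ∂μT| ≤ ε := by
  obtain ⟨C₀, m, hle⟩ := hb
  haveI : IsProbabilityMeasure μT := hG.isProbabilityMeasure
  obtain ⟨K₁, hK₁0, hK₁⟩ := pinnedChain_gibbsMeasure_window_sq_le γ hω hl.le hβ.le hT n hg hle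
  have hIg : Integrable (fun σ => g (boxRestrictAt 0 n σ)) μT :=
    integrable_comp_boxRestrictAt_of_polyBound γ hω hl.le hβ.le hT hG hS 0 n hg ⟨C₀, m, hle⟩
  have hIg2 : Integrable (fun σ => (g (boxRestrictAt 0 n σ)) ^ 2) μT :=
    integrable_comp_boxRestrictAt_of_polyBound γ hω hl.le hβ.le hT hG hS 0 n (hg.pow 2) ⟨C₀ ^ 2, 2 * m,
      fun y => by rw [Pi.pow_apply, abs_pow, pow_mul', ← mul_pow]; exact pow_le_pow_left₀ (abs_nonneg _) (hle y) 2⟩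
  set K₂ : ℝ := ∫ σ, (g (boxRestrictAt 0 n σ)) ^ 2 ∂μT with hK₂
  have hK₂0 : 0 ≤ K₂ := integral_nonneg fun σ => sq_nonneg _
  -- truncation level and truncated profile
  set M : ℝ := 3 * (K₁ + K₂) / ε + 1 with hM
  have hM0 : 0 < M := by positivity
  have hKM : K₁ / M ≤ ε / 3 ∧ K₂ / M ≤ ε / 3 := by
    have h3 : ε / 3 * M = K₁ + K₂ + ε / 3 := by rw [hM]; field_simp
    constructor <;> rw [div_le_iff₀ hM0, h3] <;> linarith
  set gM : (Fin (n + 1) → ℝ × ℝ) → ℝ := fun y => max (-M) (min (g y) M) with hgM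
  have hgMc : Continuous gM := continuous_const.max (hg.min continuous_const)
  have hgMb : ∀ y, |gM y| ≤ M := fun y => (abs_trunc_le_and_abs_sub_trunc_le hM0 (g y)).1
  have hgMd : ∀ y, |g y - gM y| ≤ (g y) ^ 2 / M := fun y => (abs_trunc_le_and_abs_sub_trunc_le hM0 (g y)).2
  set f : PhaseSpace (n + 1) → ℝ := fun w => gM (fun j => (w.1 j, w.2 j)) / M with hf
  have hfc : Continuous f := (hgMc.comp (continuous_pi fun j =>
    ((continuous_apply j).comp continuous_fst).prodMk ((continuous_apply j).comp continuous_snd))).div_const M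
  have hf1 : ∀ w, |f w| ≤ 1 := fun w => by
    rw [hf, abs_div, abs_of_pos hM0, div_le_one hM0]; exact hgMb _
  obtain ⟨L, N₀, hLN⟩ := stub_bulkWindowEquivalence ω₂ lam β γ hω hl hβ hγ T hT μT hG hS hSS n f hfc.measurable
    hf1 (ε / (3 * M)) (by positivity)
  refine ⟨L, N₀, fun N c a hN hLa haN => ?_⟩
  set μN := (pinnedChain ω₂ lam β γ).gibbsMeasure N T with hμN
  haveI : IsProbabilityMeasure μN := pinnedChain_isProbabilityMeasure_gibbsMeasure hω hl.le hβ.le γ N hT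
  set i : Fin N := ⟨(a + c).toNat, by omega⟩ with hi
  have hiv : i.val = (a + c).toNat := rfl
  have key := hLN N hN i (by rw [hiv]; omega) (by rw [hiv]; omega)
  -- identify the windows
  have hwin : ∀ z : PhaseSpace N, boxRestrictAt a n (embed N c z) =
      fun j : Fin (n + 1) => (z.1 ⟨i.val + j.val, by omega⟩, z.2 ⟨i.val + j.val, by omega⟩) := by
    intro z; funext j
    rw [boxRestrictAt_apply, embed_apply_of N c z (z := a + ((j : ℕ) : ℤ)) (by constructor <;> omega)]
    have h1 : (a + ((j : ℕ) : ℤ) + c).toNat = i.val + j.val := by rw [hiv]; omega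
    exact Prod.ext (congrArg z.1 (Fin.ext h1)) (congrArg z.2 (Fin.ext h1))
  have hbox0 : ∀ σ : ChainConfig,
      (fun j : Fin (n + 1) => ((boxPhaseAt 0 n σ).1 j, (boxPhaseAt 0 n σ).2 j)) = boxRestrictAt 0 n σ := by
    intro σ; funext j; simp [boxPhaseAt]
  have hfN : ∀ z : PhaseSpace N,
      f (fun j : Fin (n + 1) => z.1 ⟨i.val + j.val, by omega⟩, fun j : Fin (n + 1) => z.2 ⟨i.val + j.val, by omega⟩) =
        gM (boxRestrictAt a n (embed N c z)) / M := by
    intro z; rw [hwin z]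
  have hfT : ∀ σ, f (boxPhaseAt 0 n σ) = gM (boxRestrictAt 0 n σ) / M := by
    intro σ; rw [← hbox0 σ]
  have key' : |(∫ z, gM (boxRestrictAt a n (embed N c z)) ∂μN) - ∫ σ, gM (boxRestrictAt 0 n σ) ∂μT| ≤ ε / 3 := by
    simp_rw [hfN, hfT] at key
    rw [integral_div, integral_div, ← sub_div, abs_div, abs_of_pos hM0, div_le_iff₀ hM0] at key
    calc _ ≤ ε / (3 * M) * M := key
      _ = ε / 3 := by field_simp
  -- truncation errors
  obtain ⟨hI1, hI2, hK₁N⟩ := hK₁ N i.val (by omega)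
  have hmeasW : Measurable fun z : PhaseSpace N => boxRestrictAt a n (embed N c z) :=
    (boxRestrictAt_measurable a n).comp (WindowLimit.measurable_embed N c)
  have hI1' : Integrable (fun z => g (boxRestrictAt a n (embed N c z))) μN := by simp only [hwin]; exact hI1
  have hI2' : Integrable (fun z => (g (boxRestrictAt a n (embed N c z))) ^ 2) μN := by simp only [hwin]; exact hI2
  have hK₁N' : ∫ z, (g (boxRestrictAt a n (embed N c z))) ^ 2 ∂μN ≤ K₁ := by simp only [hwin]; exact hK₁N
  have hIMN : Integrable (fun z => gM (boxRestrictAt a n (embed N c z))) μN :=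
    (integrable_const M).mono' ((hgMc.measurable.comp hmeasW).aestronglyMeasurable)
      (Filter.Eventually.of_forall fun z => by rw [Real.norm_eq_abs]; exact hgMb _)
  have hIMT : Integrable (fun σ => gM (boxRestrictAt 0 n σ)) μT :=
    (integrable_const M).mono' ((hgMc.measurable.comp (boxRestrictAt_measurable 0 n)).aestronglyMeasurable)
      (Filter.Eventually.of_forall fun σ => by rw [Real.norm_eq_abs]; exact hgMb _)
  have eN : |(∫ z, g (boxRestrictAt a n (embed N c z)) ∂μN) - ∫ z, gM (boxRestrictAt a n (embed N c z)) ∂μN| ≤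
      ε / 3 := by
    rw [← integral_sub hI1' hIMN]
    calc _ ≤ ∫ z, |g (boxRestrictAt a n (embed N c z)) - gM (boxRestrictAt a n (embed N c z))| ∂μN :=
          abs_integral_le_integral_abs
      _ ≤ ∫ z, (g (boxRestrictAt a n (embed N c z))) ^ 2 / M ∂μN :=
          integral_mono_of_nonneg (Filter.Eventually.of_forall fun z => abs_nonneg _) (hI2'.div_const M)
            (Filter.Eventually.of_forall fun z => hgMd _)
      _ ≤ K₁ / M := by rw [integral_div]; exact div_le_div_of_nonneg_right hK₁N' hM0.le
      _ ≤ ε / 3 := hKM.1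
  have eT : |(∫ σ, g (boxRestrictAt 0 n σ) ∂μT) - ∫ σ, gM (boxRestrictAt 0 n σ) ∂μT| ≤ ε / 3 := by
    rw [← integral_sub hIg hIMT]
    calc _ ≤ ∫ σ, |g (boxRestrictAt 0 n σ) - gM (boxRestrictAt 0 n σ)| ∂μT := abs_integral_le_integral_abs
      _ ≤ ∫ σ, (g (boxRestrictAt 0 n σ)) ^ 2 / M ∂μT :=
          integral_mono_of_nonneg (Filter.Eventually.of_forall fun σ => abs_nonneg _) (hIg2.div_const M)
            (Filter.Eventually.of_forall fun σ => hgMd _)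
      _ ≤ K₂ / M := by rw [integral_div]
      _ ≤ ε / 3 := hKM.2
  -- assemble
  rw [integral_comp_boxRestrictAt_eq_anchor_zero hS a n hg.measurable]
  have habs : ∀ A B C D : ℝ, |A - D| ≤ |A - B| + |B - C| + |D - C| := fun A B C D => by
    calc |A - D| = |(A - B) + (B - C) + (C - D)| := by ring_nf
      _ ≤ |A - B| + |B - C| + |C - D| := abs_add_three _ _ _
      _ = _ := by rw [abs_sub_comm C D]
  linarith [habs (∫ z, g (boxRestrictAt a n (embed N c z)) ∂μN) (∫ z, gM (boxRestrictAt a n (embed N c z)) ∂μN)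
    (∫ σ, gM (boxRestrictAt 0 n σ) ∂μT) (∫ σ, g (boxRestrictAt 0 n σ) ∂μT)]

/-- **Registered sub-goal (clause (b1), infinite volume, of `stub_equilibriumPackage`)**: window observables of
polynomial growth are integrable under every shift-invariant Gibbs state of the pinned chain. [folklore] -/
theorem equilibriumPackage_integrableWindow :
    ∀ ω₂ lam β γ : ℝ, 0 < ω₂ → 0 ≤ lam → 0 ≤ β → ∀ T : ℝ, 0 < T →
      ∀ μ : Measure ChainConfig, (pinnedChain ω₂ lam β γ).IsChainGibbsMeasure T μ → IsShiftInvariant μ →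
      ∀ (a : ℤ) (n : ℕ) (g : (Fin (n + 1) → ℝ × ℝ) → ℝ), Continuous g →
        (∃ (C₀ : ℝ) (m : ℕ), ∀ y, |g y| ≤ C₀ * (1 + ‖y‖) ^ m) →
        Integrable (fun σ => g (boxRestrictAt a n σ)) μ :=
  fun _ω₂ _lam _β γ hω hl hβ _T hT _μ hμ hS a n _g hg hb =>
    integrable_comp_boxRestrictAt_of_polyBound γ hω hl hβ hT hμ hS a n hg hb

/-- **Registered sub-goal (clause (b4) of `stub_equilibriumPackage`)**: anchor-uniform thermodynamic limit of
deep-window Gibbs expectations of continuous observables of polynomial growth. [folklore] -/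
theorem equilibriumPackage_windowThermodynamicLimit :
    ∀ ω₂ lam β γ : ℝ, 0 < ω₂ → 0 < lam → 0 < β → 0 < γ → ∀ T : ℝ, 0 < T →
      ∀ μT : Measure ChainConfig, (pinnedChain ω₂ lam β γ).IsChainGibbsMeasure T μT → IsShiftInvariant μT →
      (pinnedChain ω₂ lam β γ).HasSuperstabilityEstimate μT →
      ∀ (n : ℕ) (g : (Fin (n + 1) → ℝ × ℝ) → ℝ), Continuous g →
        (∃ (C₀ : ℝ) (m : ℕ), ∀ y, |g y| ≤ C₀ * (1 + ‖y‖) ^ m) →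
        ∀ ε : ℝ, 0 < ε → ∃ L N₀ : ℕ, ∀ (N c : ℕ) (a : ℤ), N₀ ≤ N → (L : ℤ) ≤ a + c →
          a + c + n + L < N →
          |(∫ z, g (boxRestrictAt a n (embed N c z)) ∂((pinnedChain ω₂ lam β γ).gibbsMeasure N T)) -
              ∫ σ, g (boxRestrictAt a n σ) ∂μT| ≤ ε :=
  fun _ω₂ _lam _β γ hω hl hβ hγ _T hT _μT hG hS hSS n g hg hb ε hε =>
    tendsto_window_gibbsMeasure_of_polyBound γ hω hl hβ hγ hT hG hS hSS n g hg hb ε hε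

end Summit.AtomisticToContinuum.FouriersLaw.Theorems.LocalOhmBirth

end
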